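import Summits.ResolutionOfSingularities.ResolutionOfSingularities.Theorems.PPowerTowers
import Summits.ResolutionOfSingularities.ResolutionOfSingularities.Theorems.AbsoluteGiraudKernel
import Summits.ResolutionOfSingularities.ResolutionOfSingularities.Theorems.FrobeniusLadderFInjectiveMacaulayficationCentreSpread
import Summits.ResolutionOfSingularities.ResolutionOfSingularities.Theorems.TameCutStage
import Summits.ResolutionOfSingularities.ResolutionOfSingularities.Theorems.LatencyCutCells
import Mathlib.Algebra.CharP.Lemmas
import HarnessLib

/-!
# PPowerSpan — decomp-res node «KangarooCut» (lens-4 g24, critic rows 148/148a), tree file 1/5 of the node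

Content VERBATIM from the decomp-res lens-4 g24 TREE-FACING COMPANION
`HOME/decomp-res-lens-4/g24/tree/KangarooCutTree.lean` (sha256 76e53063…, 770 l;
HOME = run/shared/lean/pub/decomp-res) = the NEW PART §60–§63 of the node
`HOME/decomp-res-lens-4/g24/KangarooCut.lean` (pin f422af60, l. 1026–1759, byte-identical);
the node's carried g23 block «FrobeniusForm» is ALREADY in the tree as `Theorems/FrobeniusGain` ·
`PPowerFormLucas` · `PPowerForm` · `PPowerTowers` and is not
landed again.  Critic: CRITIC-LEDGER rows 148 (CLEARED, DECIDED +1: the jump-free bed ⊆ `ContactHugging`) and 148a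
(the companion = the landing unit); landing
order 2026-08-30T22:00:50Z / 22:19:25Z.  Landed by decomp-res writer g8 in the lens's namespace
`…Theorems.HugValuationCut`, split CONE-AWARE for the
400-line limit: `PPowerSpan` (§60) · `KangarooTransport` (§61) · `KangarooTowers` (§62) · `KangarooCutCells`
(§63 minus the three 31571 up-links) are
OUTSIDE the Theses cone (importable by the route file); `MaxContactCutKangarooCut` (§63's three `_of_item` up-links
from `MaxContactCut.NoContactHuggingTowers`)
is the in-cone wiring file.  All `--supports stmt-ResolutionOfSingularities-28338`.  Aside bookkeeping (critic row
148 / rider 22:00:50Z (3)): exactly ONE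
successor aside `NoWildKangarooOffLocusTowers` (home `KangarooCutCells`) SUPERSEDES 28338
`LCNoWildContactFreeOffLocusTowers` once this node and
`Theorems/ContactFreeIsPPower` (lens-6 g19 companion, every-field iff `noWildContactFreeOffLocusTowers_iff_pPower`)
are both in the tree — exactness chain
`noWildContactFreeOffLocusTowers_iff_pPower` + `noWildPPowerOffLocusTowers_iff_kangaroo (h31571)`.

§60 (companion l. 33–130 = node l. 1027–1135) WEAK CONTACT IN CHARACTERISTIC `p` — the degree-`p` span lemma:
`exists_pow_congr_of_mem_pPowerSpan`,
`exists_weakContact_of_le_pPowerSpan`, `not_mem_sq_of_pow_congr`, `exists_pth_root_residue` (KERNEL, PROVED, 0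
sorry).  Cone-free.

[WRITER NOTE (decomp-res writer g8): section split only; namespace, universes, section variables and every
declaration exactly as in the companion
(global `set_option` dropped; the cone import `MaxContactCutTameCut` of the companion is replaced in the cone-free
files by the cone-free homes of what the
proofs use: `AbsoluteGiraudKernel` (`AbsoluteContactClasses.point_round_chart`),
`FrobeniusLadderFInjectiveMacaulayficationCentreSpread` (`centreSpread`),
`PPowerTowers`, `TameCutStage`, `LatencyCutCells`; the `open …Theses` line lives only in the wiring file).]

(Sources: Hauser2010Kangaroo; Moh1987; Hironaka1970Additive; Giraud1975; CossartPiltant2008 Prop. 4.2;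
CossartPiltant2019 Prop. 2.50; EGA IV₄ 16.11.2.)
-/

noncomputable section

open CategoryTheory AlgebraicGeometry IsLocalRing
open Literature.AlgebraicGeometry.Resolution
open Summit.ResolutionOfSingularities.ResolutionOfSingularities.Theorems
open WeakOrderReduction ForcedTowerClasses DivergentTowerClasses MonomialTowerClasses
open HugDimensionClasses HugDimensionKernels SurfaceShadowClasses SurfaceShadowKernels
open NearPointCut (SingularClass)
open AbsoluteContactClasses (IsAbsContactAt SepResidueAt diffIdeal_restrict_le stalkMap_comp_toStalk_eq_stalkHom)
open scoped BigOperators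

namespace Summit.ResolutionOfSingularities.ResolutionOfSingularities.Theorems.HugValuationCut

/-! ## §60 (g24 · NEW · KERNEL) WEAK CONTACT IN CHARACTERISTIC `p` — the degree-`p` span lemma

At a point whose local ring has characteristic `p` and whose residue classes have `p`-th roots (perfect residue field), an
element of the `p`-POWER SPAN OF DEGREE `p` (`⟨h^p : h ∈ 𝔪⟩ + 𝔪^{p+1}`, i.e. `PPowerFormAt p 𝓘 p y`:
the WEIGHT EQUALS THE
CHARACTERISTIC) is the `p`-th power of ONE element modulo `𝔪^{p+1}`: Frobenius is additive and the coefficients are `p`-th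
powers modulo `𝔪`.  If the element computes the order, the `p`-th root is a REGULAR PARAMETER `z ∈ 𝔪 ∖
𝔪²`: `V(z)` is a regular
hypersurface germ of WEAK (naive) CONTACT — the hypersurface the kangaroo phenomenon is about (Hauser2010Kangaroo; Moh1987;
Hironaka1970Additive).  No Hasse system, no base field, no regularity. -/

section WeakContact

variable {R : Type*} [CommRing R] [IsLocalRing R] (p : ℕ) [Fact p.Prime] [CharP R p]

/-- **KERNEL (PROVED): FROBENIUS LINEARITY OF THE `p`-POWER SPAN modulo `𝔪^{p+1}`** — if every residue class has a `p`-th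
root (`∀ a, ∃ b, a − b^p ∈ 𝔪`), every element of the ideal `⟨h^p : h ∈ 𝔪⟩` is `≡ z^p (mod
𝔪^{p+1})` for some `z ∈ 𝔪`
(`(z₁ + z₂)^p = z₁^p + z₂^p`; `a·z^p ≡ (b z)^p` when `a ≡ b^p (mod 𝔪)`). (Sources:
Hironaka1970Additive; Hauser2010Kangaroo, §«weak
contact»; folklore.) -/
theorem exists_pow_congr_of_mem_pPowerSpan (hperf : ∀ a : R, ∃ b : R, a - b ^ p ∈ maximalIdeal R) {g : R}
    (hg : g ∈ Ideal.span ((fun h : R => h ^ p) '' ↑(maximalIdeal R))) :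
    ∃ z ∈ maximalIdeal R, g - z ^ p ∈ maximalIdeal R ^ (p + 1) := by
  have hp0 : p ≠ 0 := (Fact.out : p.Prime).ne_zero
  induction hg using Submodule.span_induction with
  | mem x hx =>
    obtain ⟨h, hh, rfl⟩ := hx
    exact ⟨h, hh, by simp⟩
  | zero => exact ⟨0, zero_mem _, by simp [zero_pow hp0]⟩
  | add x y _ _ hx hy =>
    obtain ⟨z₁, hz₁, h₁⟩ := hx
    obtain ⟨z₂, hz₂, h₂⟩ := hy
    refine ⟨z₁ + z₂, add_mem hz₁ hz₂, ?_⟩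
    have e : x + y - (z₁ + z₂) ^ p = (x - z₁ ^ p) + (y - z₂ ^ p) := by
      rw [add_pow_char_of_commute p (Commute.all z₁ z₂)]; ring
    rw [e]
    exact add_mem h₁ h₂
  | smul a x _ hx =>
    obtain ⟨z, hz, h⟩ := hx
    obtain ⟨b, hb⟩ := hperf a
    refine ⟨b * z, Ideal.mul_mem_left _ b hz, ?_⟩
    have e : a • x - (b * z) ^ p = a * (x - z ^ p) + (a - b ^ p) * z ^ p := by rw [smul_eq_mul]; ring
    rw [e]
    refine add_mem (Ideal.mul_mem_left _ a h) ?_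
    rw [pow_succ']
    exact Ideal.mul_mem_mul hb (Ideal.pow_mem_pow hz p)

/-- **KERNEL (PROVED): THE DEGREE-`p` SPAN LEMMA / EXISTENCE OF WEAK CONTACT** — if `I ⊆ ⟨h^p : h ∈ 𝔪⟩
+ 𝔪^{p+1}` (the
`p`-power form of weight `p`) and the residue classes have `p`-th roots, EVERY `f ∈ I` is `≡ z^p (mod 𝔪^{p+1})` for some
`z ∈ 𝔪`. (Sources: Hironaka1970Additive; Hauser2010Kangaroo; CossartPiltant2008, §2.) -/
theorem exists_weakContact_of_le_pPowerSpan (hperf : ∀ a : R, ∃ b : R, a - b ^ p ∈ maximalIdeal R) {I : Ideal R}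
    (hI : I ≤ Ideal.span ((fun h : R => h ^ p) '' ↑(maximalIdeal R)) ⊔ maximalIdeal R ^ (p + 1)) {f : R} (hf : f ∈ I) :
    ∃ z ∈ maximalIdeal R, f - z ^ p ∈ maximalIdeal R ^ (p + 1) := by
  obtain ⟨g, hg, r, hr, hgr⟩ := Submodule.mem_sup.mp (hI hf)
  obtain ⟨z, hz, hzg⟩ := exists_pow_congr_of_mem_pPowerSpan p hperf hg
  refine ⟨z, hz, ?_⟩
  have e : f - z ^ p = (g - z ^ p) + r := by rw [← hgr]; ring
  rw [e]
  exact add_mem hzg hr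

omit [IsLocalRing R] [CharP R p] in
/-- **the weak-contact element is a REGULAR PARAMETER**: if `f ∉ M^{p+1}` and `f − c·z^p ∈ M^{p+1}` then `z ∉ M²`
(`z ∈ M²` would put `z^p ∈ M^{2p} ⊆ M^{p+1}`). [folklore] -/
theorem not_mem_sq_of_pow_congr (M : Ideal R) {f z c : R} (hf : f ∉ M ^ (p + 1)) (h : f - c * z ^ p ∈ M ^ (p + 1)) :
    z ∉ M ^ 2 := by
  intro hz
  have h2p : p + 1 ≤ 2 * p := by have := (Fact.out : p.Prime).two_le; omega
  have hzp : c * z ^ p ∈ M ^ (p + 1) := by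
    refine Ideal.mul_mem_left _ c (Ideal.pow_le_pow_right h2p ?_)
    rw [pow_mul]
    exact Ideal.pow_mem_pow hz p
  exact hf (by simpa using add_mem h hzp)

end WeakContact

section ResiduePlumbing

variable {K : Type} [Field K]

/-- **Residue plumbing (PROVED): over a PERFECT field, at a CLOSED point of a scheme locally of finite type, every residue class
of the local ring has a `p`-th root** — `κ(y)` is finite over `k` (tree `module_finite_residueField_of_isClosed`), hence
perfect (`Algebra.IsAlgebraic.perfectField`), hence Frobenius is onto. (Sources: GortzWedhorn2020, Prop. 3.33;
StacksProject, Tag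
00TV; folklore.) -/
theorem exists_pth_root_residue (p : ℕ) [hp : Fact p.Prime] [CharP K p] [PerfectField K] {Y : Scheme.{0}}
    (g : Y ⟶ Spec (.of K)) [LocallyOfFiniteType g] {y : Y} (hy : IsClosed ({y} : Set Y)) (a : Y.presheaf.stalk y) :
    ∃ b : Y.presheaf.stalk y, a - b ^ p ∈ maximalIdeal (Y.presheaf.stalk y) := by
  letI := stalkAlgebra (g.appTop.hom.comp (Scheme.ΓSpecIso (.of K)).inv.hom) y
  haveI : Module.Finite K (ResidueField (Y.presheaf.stalk y)) :=
    AbsoluteContactClasses.module_finite_residueField_of_isClosed g hy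
  haveI : Algebra.IsAlgebraic K (ResidueField (Y.presheaf.stalk y)) := Algebra.IsAlgebraic.of_finite K _
  haveI : PerfectField (ResidueField (Y.presheaf.stalk y)) := Algebra.IsAlgebraic.perfectField K
  haveI : CharP (ResidueField (Y.presheaf.stalk y)) p :=
    charP_of_injective_algebraMap (algebraMap K (ResidueField (Y.presheaf.stalk y))).injective p
  haveI : ExpChar (ResidueField (Y.presheaf.stalk y)) p := ExpChar.prime hp.out
  obtain ⟨β, hβ⟩ := surjective_frobenius (ResidueField (Y.presheaf.stalk y)) p (residue _ a)
  obtain ⟨b, rfl⟩ := residue_surjective β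
  refine ⟨b, ?_⟩
  rw [← residue_eq_zero_iff, map_sub, map_pow, ← frobenius_def, hβ, sub_self]

end ResiduePlumbing

end Summit.ResolutionOfSingularities.ResolutionOfSingularities.Theorems.HugValuationCut
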